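import Mathlib
import Summits.Ventures.PercRepro.TriangleCapDiagonalLocus
import Summits.Ventures.PercRepro.TriangleCapTFamilyGen
import Summits.Ventures.PercRepro.TriangleCapDiamondExtremal
import Summits.Ventures.PercRepro.TriangleCapSecondBestParity

/-!
# PercRepro — THE THIRD ORDER ON THE DIAGONAL CELL `(12, 4, 0)` IS THE HUNG `K_{5,6}`, NOT THE THIRD BIPARTITION:
a `K₄⁻`-free graph with `32` edges on `12` vertices is `4`-bipartite (then `K_{4,8}`), or `5`-bipartite (then at
least `B2 = 24` below `m k`), or at least `26` below `m k` — sharp by `K_{5,6}` with a vertex hung on an edge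
(p3, gen 46; part 199f)

§10by(o) conjectured that on the diagonal `(k, a, 0)`, `2a + 4 ≤ k ≤ 3a + 2`, the graphs that are neither `a`- nor
`(a + 1)`-bipartite are at least `B3 = (2k − 4a − 4)(4a + 3 − k)` below `m k`, sharp by `K_{a+2,k−a−2}` minus a
`(2k − 4a − 4)`-star. At `k = 3a` this is FALSE: the hung `K_{a+1,2a−2}` has `a (k − a)` edges, one triangle, and
gap `2a² − 6 < B3 = 2a² + 2a − 12` (`a ≥ 4`). Here `a = 4`, `k = 12`: the hung `K_{5,6}` (`tFamilyGen 11 5 0`, part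
198's family `T` read on the cell `(12, 5, 3)`) has `Σ_v d(v)² = 358 = m k − 26`, against `356` for `K_{6,6}` minus a
`4`-star. THE BOUND `26` is the vertex-type argument of part 199a: a vertex at the cap `8` makes `D` `4`-bipartite
(`diag_cap_gen`); every degree in `[5, 7]` gives `k (k − 9) = 36` by the convexity of the row `5`
(`diag_convex_gen`); a vertex `z` of degree `d ≤ 4` is deleted onto `11` vertices: `d ≤ 1` is impossible (`4 · 31 >
121`); `d = 2`: `D − z` is `K_{5,6}` exactly (`k4mFree_extremal_complete`) and the two neighbours of `z` on the
`5`-side make `D` `5`-bipartite, on the `6`-side `6`-bipartite with `4` missing pairs (closed form `356`), one on each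
side is the hung `K_{5,6}` itself (`330 + 22 + 6 = 358`); `d = 3`: `D − z` on `(11, 5, 1)` at `≤ 310`, `T ≤ 18`:
`358`; `d = 4`: `D − z` on the diagonal `(11, 4, 0)`: `K_{4,7}` (the four neighbours of `z` on one side: `D` is `4`-
or `5`-bipartite), or `≤ 290` (`T ≤ 24`: `358`), or exactly `292` — §10bx's second-order locus (`diag_second_locus`):
`K_{5,6}` minus a `2`-star, whose `5`-side takes the neighbours of `z` (`5`-bipartite), or all off it (`6`-bipartite,
`356`), or a neighbour off it has degree `≤ 5` and `T ≤ 23`: `292 + 46 + 20 = 358`. So the corrected third-order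
statement on the diagonal reads `min {B3, 2a² − 6 at k = 3a}`; for `a = 3` the `k = 3a` term is §10bx's exception
`(9, 18)` (the hung `K_{4,4}`, gap `12 = 2·9 − 6`). Axioms: standard.
-/

namespace PercRepro

namespace TriangleCap

namespace C047

open Finset

variable {V : Type*} [Fintype V] [DecidableEq V]

/-- A sum over `N` of values `≤ c`, one of which (`w₀ ∈ N`) is `≤ e`, is at most `c (|N| − 1) + e`. -/
theorem sum_le_of_mem_le_gen {W : Type*} [DecidableEq W] (N : Finset W) (f : W → ℕ) (c e : ℕ) {w₀ : W}
    (hw₀ : w₀ ∈ N) (hf : ∀ w ∈ N, f w ≤ c) (h0 : f w₀ ≤ e) : ∑ w ∈ N, f w + c ≤ N.card * c + e := by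
  rw [← add_sum_erase N f hw₀]
  have h1 : ∑ w ∈ N.erase w₀, f w ≤ ∑ _w ∈ N.erase w₀, c :=
    sum_le_sum (fun w hw => hf w (mem_of_mem_erase hw))
  rw [sum_const, smul_eq_mul, card_erase_of_mem hw₀] at h1
  have h2 : 1 ≤ N.card := card_pos.mpr ⟨w₀, hw₀⟩
  have h3 : (N.card - 1) * c + c = N.card * c := by
    obtain ⟨n, hn⟩ : ∃ n, N.card = n + 1 := ⟨N.card - 1, by omega⟩
    rw [hn, Nat.add_sub_cancel]
    ring
  omega

/-- **THE THIRD ORDER ON `(12, 32)`:** `K₄⁻`-free, `k = 12`, `m = 32` ⇒ `D` is a spanning subgraph of some `K(A, Aᶜ)`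
with `|A| = 4`, or of one with `|A| = 5`, or `Σ_v d(v)² + 26 ≤ m k`. -/
theorem four_diag_third_order_twelve (D : SimpleGraph V) [DecidableRel D.Adj] (hK : K4mFree D)
    (hk : Fintype.card V = 12) (hm : D.edgeFinset.card = 32) :
    (∃ A : Finset V, A.card = 4 ∧ BipSub D A) ∨ (∃ A : Finset V, A.card = 5 ∧ BipSub D A) ∨
      ∑ v, deg D v * deg D v + 26 ≤ D.edgeFinset.card * Fintype.card V := by
  -- (A) a vertex at the cap `8` makes `D` `4`-bipartite
  by_cases hx : ∃ x, deg D x + 4 = Fintype.card V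
  · obtain ⟨x, hx⟩ := hx
    exact Or.inl (diag_cap_gen D hK 4 (le_refl 4) (by omega) (by rw [hk, hm]) x hx)
  push Not at hx
  have hcap : ∀ v, deg D v + 4 ≤ Fintype.card V := fun v =>
    deg_add_le_card_of_dense D hK 4 (by norm_num) (by omega)
      (cap_arith 4 (Fintype.card V) D.edgeFinset.card 0 (by norm_num) (by omega) (by omega)) v
  have hcap' : ∀ v, deg D v + 4 + 1 ≤ Fintype.card V := fun v => by
    have h1 := hcap v
    have h2 := hx v
    omega
  have hcap7 : ∀ v, deg D v ≤ 6 + 1 := fun v => by have := hcap' v; omega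
  -- (B) every degree `≥ 5`: the convexity of the row `5` gives `36`
  by_cases hdeg : ∀ v, 4 + 1 ≤ deg D v
  · right; right
    have h := diag_convex_gen D 4 (by omega) (by rw [hk, hm]) hcap' hdeg
    rw [hk, hm] at h ⊢
    omega
  push Not at hdeg
  obtain ⟨z, hz⟩ := hdeg
  -- the deletion bookkeeping
  have hK' := k4mFree_del D hK z
  have hcard' := card_del z
  have hedges' := card_edges_del D z
  have hsq := sum_deg_sq_del D z
  have hT := sum_del_nbhd_le D z 6 hcap7
  have hNz := card_nbhd_del D z
  obtain ⟨T, hTdef⟩ : ∃ T, ∑ a : {v : V // v ≠ z}, (if D.Adj a.1 z then deg (del D z) a else 0) = T := ⟨_, rfl⟩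
  obtain ⟨S', hS'def⟩ : ∃ S', ∑ a : {v : V // v ≠ z}, deg (del D z) a * deg (del D z) a = S' := ⟨_, rfl⟩
  obtain ⟨m', hm'def⟩ : ∃ m', (del D z).edgeFinset.card = m' := ⟨_, rfl⟩
  obtain ⟨Nz, hNzdef⟩ : ∃ Nz : Finset {v : V // v ≠ z},
      Nz = univ.filter (fun a : {v : V // v ≠ z} => D.Adj a.1 z) := ⟨_, rfl⟩
  have hmemNz : ∀ a : {v : V // v ≠ z}, a ∈ Nz ↔ D.Adj a.1 z := fun a => by
    rw [hNzdef, mem_filter]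
    simp only [mem_univ, true_and]
  have hTfilt : T = ∑ a ∈ Nz, deg (del D z) a := by
    rw [← hTdef, hNzdef, sum_filter]
  rw [← hNzdef] at hNz
  rw [hTdef, hS'def] at hsq
  rw [hTdef] at hT
  rw [hm'def] at hedges'
  have hcardW' : Fintype.card {v : V // v ≠ z} = 11 := by omega
  have hdegNz : ∀ a ∈ Nz, deg (del D z) a ≤ 6 := fun a ha => by
    have h := deg_del D z a
    rw [if_pos ((hmemNz a).mp ha)] at h
    have := hcap7 a.1
    omega
  -- the side lemma for a `D − z` that is a spanning subgraph of `K(A', A'ᶜ)` with `|A'| = 5`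
  have hside : ∀ A' : Finset {v : V // v ≠ z}, A'.card = 5 → BipSub (del D z) A' →
      (∃ A : Finset V, A.card = 5 ∧ BipSub D A) ∨
        (∑ v, deg D v * deg D v + 26 ≤ D.edgeFinset.card * Fintype.card V) ∨
        (T + 6 ≤ deg D z * 6 + 5) := by
    intro A' hA'card hB
    by_cases hall : ∀ a : {v : V // v ≠ z}, D.Adj a.1 z → a ∈ A'
    · obtain ⟨B, hBcard, hBsub⟩ := bipSub_lift D z A' hB hall
      exact Or.inl ⟨B, by rw [hBcard, hA'card], hBsub⟩
    by_cases hnone : ∀ a : {v : V // v ≠ z}, D.Adj a.1 z → a ∉ A'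
    · right; left
      obtain ⟨A, hAcard, hAsub⟩ := bipSub_insert_of_nbhd_off D z A' hB hnone
      rw [hA'card] at hAcard
      have h := sum_deg_sq_le_of_bipSub D A hAsub 6 4 hAcard (by rw [hk, hm]) (by omega)
      rw [hk, hm] at h ⊢
      omega
    · right; right
      push Not at hall
      obtain ⟨w₀, hw₀z, hw₀A⟩ := hall
      have hdw₀ : deg (del D z) w₀ ≤ 5 := by
        have := deg_le_card_of_bipSub (del D z) A' hB w₀ hw₀A
        rw [hA'card] at this
        exact this
      rw [hTfilt, ← hNz]
      exact sum_le_of_mem_le_gen Nz (fun a => deg (del D z) a) 6 5 ((hmemNz w₀).mpr hw₀z) hdegNz hdw₀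
  have hd : deg D z = 0 ∨ deg D z = 1 ∨ deg D z = 2 ∨ deg D z = 3 ∨ deg D z = 4 := by omega
  rcases hd with hd0 | hd1 | hd2 | hd3 | hd4
  · -- `d = 0`: `32` edges on `11` vertices, impossible
    exfalso
    have h := four_mul_card_edges_le_sq (del D z) hK' (by omega)
    rw [hm'def, hcardW'] at h
    omega
  · -- `d = 1`: `31` edges on `11` vertices, impossible
    exfalso
    have h := four_mul_card_edges_le_sq (del D z) hK' (by omega)
    rw [hm'def, hcardW'] at h
    omega
  · -- `d = 2`: `D − z` is `K_{5,6}`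
    have hm'30 : m' = 30 := by omega
    obtain ⟨A', hA'card, hiff⟩ := k4mFree_extremal_complete (del D z) hK' (by omega)
      (by rw [hm'def, hcardW', hm'30])
    rw [hcardW'] at hA'card
    have hB : BipSub (del D z) A' := fun x y h => ((hiff x y).mp h).1
    rcases hside A' hA'card hB with h | h | hT'
    · exact Or.inr (Or.inl h)
    · exact Or.inr (Or.inr h)
    · right; right
      have henv := sum_deg_sq_le_of_k4mFree (del D z) hK' (by omega)
      rw [hS'def, hm'def, hcardW', hm'30] at henv
      rw [hd2] at hT'
      rw [hsq, hk, hm, hd2]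
      omega
  · -- `d = 3`: `D − z` on the cell `(11, 5, 1)` at `≤ 310`
    right; right
    have hm'29 : m' = 29 := by omega
    have hS310 : S' ≤ 310 := by
      rcases one_below_second_order_gen (del D z) hK' 5 (by norm_num) (by omega)
        (by rw [hm'def, hcardW', hm'29]) with ⟨A', hA'card, hB⟩ | h
      · have := sum_deg_sq_le_of_bipSub (del D z) A' hB 5 1 hA'card (by rw [hm'def, hcardW', hm'29])
          (by omega)
        rw [hS'def, hm'def, hcardW', hm'29] at this
        omega
      · rw [hS'def, hm'def, hcardW', hm'29] at h
        omega
    rw [hd3] at hT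
    rw [hsq, hk, hm, hd3]
    omega
  · -- `d = 4`: `D − z` on the diagonal `(11, 4, 0)`
    have hm'28 : m' = 28 := by omega
    rw [hd4] at hT hNz
    rcases diag_second_order_gen (del D z) hK' 4 (le_refl 4) (by omega) (by rw [hm'def, hcardW', hm'28])
      with ⟨A', hA'card, hA'⟩ | hgap
    · -- `D − z = K_{4,7}`: the four neighbours of `z` lie on one side
      have hfull : ∀ {x y : {v : V // v ≠ z}}, x ∈ A' → y ∉ A' → (del D z).Adj x y := fun hx hy =>
        adj_of_bipSub_full (del D z) A' hA' 4 hA'card (by rw [hm'def, hcardW', hm'28]) hx hy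
      by_cases hall : ∀ a : {v : V // v ≠ z}, D.Adj a.1 z → a ∈ A'
      · obtain ⟨B, hBcard, hB⟩ := bipSub_lift D z A' hA' hall
        exact Or.inl ⟨B, by rw [hBcard, hA'card], hB⟩
      · push Not at hall
        obtain ⟨a₀, ha₀z, ha₀A⟩ := hall
        have hoff : ∀ a : {v : V // v ≠ z}, D.Adj a.1 z → a ∉ A' := by
          intro a₁ ha₁z ha₁A
          have hne01 : a₀ ≠ a₁ := fun h => ha₀A (h ▸ ha₁A)
          obtain ⟨a₂, ha₂z, ha₂0, ha₂1⟩ : ∃ a₂ : {v : V // v ≠ z}, D.Adj a₂.1 z ∧ a₂ ≠ a₀ ∧ a₂ ≠ a₁ := by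
            have h2 : 2 < Nz.card := by omega
            obtain ⟨b₁, hb₁, b₂, hb₂, b₃, hb₃, h12, h13, h23⟩ := two_lt_card.mp h2
            rw [hmemNz] at hb₁ hb₂ hb₃
            by_cases e1 : b₁ = a₀ ∨ b₁ = a₁
            · by_cases e2 : b₂ = a₀ ∨ b₂ = a₁
              · refine ⟨b₃, hb₃, ?_, ?_⟩
                · intro h; rcases e1 with rfl | rfl <;> rcases e2 with rfl | rfl <;>
                    first | exact h12 rfl | exact h13 h | exact h13 h.symm | exact h23 h | exact h23 h.symm
                · intro h; rcases e1 with rfl | rfl <;> rcases e2 with rfl | rfl <;>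
                    first | exact h12 rfl | exact h13 h | exact h13 h.symm | exact h23 h | exact h23 h.symm
              · push Not at e2
                exact ⟨b₂, hb₂, e2.1, e2.2⟩
            · push Not at e1
              exact ⟨b₁, hb₁, e1.1, e1.2⟩
          have h10 : D.Adj a₁.1 a₀.1 := (del_adj D z a₁ a₀).mp (hfull ha₁A ha₀A)
          by_cases ha₂A : a₂ ∈ A'
          · have h20 : D.Adj a₂.1 a₀.1 := (del_adj D z a₂ a₀).mp (hfull ha₂A ha₀A)
            exact not_adj_both D hK (D.adj_symm ha₀z) (D.adj_symm ha₁z) (D.adj_symm h10)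
              (fun h => ha₂1 (Subtype.ext h).symm) (D.adj_symm ha₂z) (D.adj_symm h20)
          · have h12' : D.Adj a₁.1 a₂.1 := (del_adj D z a₁ a₂).mp (hfull ha₁A ha₂A)
            exact not_adj_both D hK (D.adj_symm ha₁z) (D.adj_symm ha₀z) h10
              (fun h => ha₂0 (Subtype.ext h).symm) (D.adj_symm ha₂z) h12'
        obtain ⟨B, hBcard, hB⟩ := bipSub_insert_of_nbhd_off D z A' hA' hoff
        exact Or.inr (Or.inl ⟨B, by rw [hBcard, hA'card], hB⟩)
    · -- `D − z` is not `4`-bipartite: `S' ≤ 292`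
      rw [hS'def, hm'def, hcardW', hm'28] at hgap
      have hnb : ¬ ∃ A' : Finset {v : V // v ≠ z}, A'.card = 4 ∧ BipSub (del D z) A' := by
        rintro ⟨A', hA'card, hA'⟩
        have hne' : Nonempty {v : V // v ≠ z} := Fintype.card_pos_iff.mp (by omega)
        obtain ⟨v⟩ := hne'
        have hstar : MissingStar (del D z) A' v := fun x y hx hy hxy =>
          absurd (adj_of_bipSub_full (del D z) A' hA' 4 hA'card (by rw [hm'def, hcardW', hm'28]) hx hy) hxy
        have h := closed_form_eq_of_missingStar (del D z) A' hA' hstar 4 0 hA'card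
          (by rw [hm'def, hcardW', hm'28]) (by omega)
        rw [hS'def, hm'def, hcardW', hm'28] at h
        simp only [zero_mul, add_zero] at h
        omega
      by_cases hS290 : S' + 2 ≤ 292
      · right; right
        rw [hsq, hk, hm, hd4]
        omega
      · have hS292 : S' = 292 := by
          obtain ⟨t, ht⟩ := even_sum_deg_sq (del D z)
          rw [hS'def] at ht
          omega
        have heq : ∑ a : {v : V // v ≠ z}, deg (del D z) a * deg (del D z) a +
            2 * 4 * (Fintype.card {v : V // v ≠ z} - 2 * 4 - 1) =
            (del D z).edgeFinset.card * Fintype.card {v : V // v ≠ z} := by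
          rw [hS'def, hm'def, hcardW', hS292, hm'28]
        obtain ⟨A', v, hA'card, hB, -⟩ := diag_second_locus (del D z) hK' 4 (le_refl 4) (by omega)
          (by rw [hm'def, hcardW', hm'28]) hnb heq
        rcases hside A' hA'card hB with h | h | hT'
        · exact Or.inr (Or.inl h)
        · exact Or.inr (Or.inr h)
        · right; right
          rw [hsq, hk, hm, hd4]
          omega

/-- **THE WITNESS: THE HUNG `K_{5,6}`** (`tFamilyGen 11 5 0`) is `K₄⁻`-free with `32` edges on `12` vertices,
bipartite for no `A`, and has `Σ_v d(v)² = 358 = m k − 26`. -/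
theorem four_diag_third_witness_twelve :
    K4mFree (tFamilyGen 11 5 0 (by norm_num)) ∧ (tFamilyGen 11 5 0 (by norm_num)).edgeFinset.card = 32 ∧
      (∀ A : Finset (Fin 12), ¬ BipSub (tFamilyGen 11 5 0 (by norm_num)) A) ∧
      ∑ v, deg (tFamilyGen 11 5 0 (by norm_num)) v * deg (tFamilyGen 11 5 0 (by norm_num)) v = 358 := by
  obtain ⟨hK, hE, hS, hnb⟩ := tFamilyGen_value 11 5 0 (by norm_num) (by norm_num) (by norm_num)
  have hE' : (tFamilyGen 11 5 0 (by norm_num)).edgeFinset.card = 32 := by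
    norm_num at hE
    omega
  refine ⟨hK, hE', hnb, ?_⟩
  rw [hE'] at hS
  norm_num at hS
  omega

/-- **THE THIRD-BEST VALUE ON `(12, 32)` IS `358`, THE HUNG `K_{5,6}`:** every `K₄⁻`-free graph on `Fin 12` with
`32` edges that is neither `4`- nor `5`-bipartite has `Σ_v d(v)² ≤ 358`, and the hung `K_{5,6}` attains it — the
third bipartition `K_{6,6}` minus a `4`-star (`356`) is NOT the third family at `k = 3a`. -/
theorem four_diag_third_best_twelve :
    (∀ (D : SimpleGraph (Fin 12)) [DecidableRel D.Adj], K4mFree D → D.edgeFinset.card = 32 →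
        (¬ ∃ A : Finset (Fin 12), A.card = 4 ∧ BipSub D A) → (¬ ∃ A : Finset (Fin 12), A.card = 5 ∧ BipSub D A) →
        ∑ v, deg D v * deg D v ≤ 358) ∧
      ∃ (D : SimpleGraph (Fin 12)) (_ : DecidableRel D.Adj), K4mFree D ∧ D.edgeFinset.card = 32 ∧
        (∀ A : Finset (Fin 12), ¬ BipSub D A) ∧ ∑ v, deg D v * deg D v = 358 := by
  refine ⟨?_, ?_⟩
  · intro D _ hK hm h4 h5
    have hk : Fintype.card (Fin 12) = 12 := Fintype.card_fin 12
    rcases four_diag_third_order_twelve D hK hk hm with h | h | h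
    · exact absurd h h4
    · exact absurd h h5
    · rw [hk, hm] at h
      omega
  · obtain ⟨hK, hE, hnb, hS⟩ := four_diag_third_witness_twelve
    exact ⟨tFamilyGen 11 5 0 (by norm_num), inferInstance, hK, hE, hnb, hS⟩

end C047

end TriangleCap

end PercRepro
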